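import Summits.CriticalPhenomena.CardyFormulaZ2.Theorems.CardyBoundaryCoulombGasHalfPlaneOneArmThirdIpRecursionOfFact
import Summits.CriticalPhenomena.CardyFormulaZ2.Theorems.CardyBoundaryCoulombGasHalfPlaneOneArmThirdPassageLeArm
import HarnessLib

/-!
# How far the non-degeneracy input S2 of line `iic-trace-flux-pairing` is from the tree's named facts:
# the DIAGONAL half-plane one-arm lower bound `≥ c n^{-1/3}` from Ikhlef–Ponsaing alone

Crux `ParafermionToSLESixFamilies` (stmt-CriticalPhenomena-11389), route `CardyComplexCone`, line `iic-trace-flux-pairing`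
(skeleton `Cruxes/ParafermionToSLESixFamilies/Lines/iic_trace_flux_pairing.lean`). Its stub S2 `stub_halfPlaneOneArmLower` asks for
the AXIS half-plane one-arm lower bound `π₁⁺(n) ≥ c n^{-1/3}` of bond percolation on `ℤ²` at `p = 1/2` (open). This file records,
kernel-checked, what the tree's one relevant named fact gives instead: CONDITIONALLY on Ikhlef–Ponsaing's first-passage closed form
(`Literature.Probability.Percolation.IkhlefPonsaingFirstPassage`, J. Stat. Phys. 149 (2012), arXiv:1202.5476, Prop. 4.7 — an integrable,
Bethe-ansatz identity, vendored unproved), the DIAGONAL half-plane one-arm probability obeys the up-to-constants lower bound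

  `π◇(n) := P_{1/2}[0 ↔ {s = -n} ∪ {d = ±n} inside {-n ≤ s ≤ 1, |d| ≤ n}] ≥ (2n+1)^{-1/3}`   (`s = v₀+v₁`, `d = v₀-v₁`, `n ≥ 1`),

hence `π◇(n) ≥ 3^{-1/3} n^{-1/3}` eventually — the exact quantifier shape of S2 with the diagonal event in place of the axis one
(`diagHalfPlaneOneArmLower_of_ikhlefPonsaing`, registered glue). Ingredients, all landed for crux 5662 `HalfPlaneOneArmThird`
(line `ip-passage-stirling`): the two-step recursion of the wall-passage probability `P_b(2m+1)` given the fact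
(`stub_ipRecursion_of_ikhlefPonsaing`), and the a.s. inclusion `P_b(2n+1) ≤ π◇(n)` (`stub_passageLeArm`). New here: the elementary
monotonicity `(2m+3)·P_b(2m+3)³ ≥ (2m+1)·P_b(2m+1)³` (a polynomial identity with non-negative coefficients), so `P_b(2m+1) ≥ (2m+1)^{-1/3}`
from `P_b(1) = 1` — the lower companion of `EdgePrecompact.QkzStripBoundaryArm.stub_ipAsymptotic` (`P_b(2m+1) ≤ 2(2m+1)^{-1/3}`).
What does NOT follow: the axis form S2 — the only orientation transfer in the tree (`stub_rotationTransfer`, from DKKMO Cor. 1.3) is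
in LOG form; no up-to-constants comparison of the axis and diagonal half-plane arms of `ℤ²` is known.
-/

noncomputable section

namespace Summit.CriticalPhenomena.CardyFormulaZ2.Cruxes.ParafermionToSLESixFamilies.IicTraceFluxPairing

open Filter Topology MeasureTheory
open Literature.Probability.Percolation Literature.Probability.LatticeModels
open Summit.CriticalPhenomena.CardyFormulaZ2.Cruxes.HalfPlaneOneArmThird.IpPassageStirling
  (stub_ipRecursion_of_ikhlefPonsaing stub_passageLeArm)

/-- The polynomial certificate behind the monotonicity of `(2m+1)·P_b(2m+1)³`: with `N = (3x+5)(4x+3)(6x+7)` and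
`D = (3x+4)(4x+7)(6x+5)`, `D³(2x+1) ≤ N³(2x+3)` for `x ≥ 0` (the difference has non-negative coefficients). -/
theorem diagArm_step_poly (x : ℝ) (hx : 0 ≤ x) :
    ((3 * x + 4) * (4 * x + 7) * (6 * x + 5)) ^ 3 * (2 * x + 1) ≤
      ((3 * x + 5) * (4 * x + 3) * (6 * x + 7)) ^ 3 * (2 * x + 3) := by
  have hQ : 0 ≤ 728875 + 5143775 * x + 15679125 * x ^ 2 + 26955724 * x ^ 3 + 28587384 * x ^ 4 +
      19154304 * x ^ 5 + 7920720 * x ^ 6 + 1848960 * x ^ 7 + 186624 * x ^ 8 := by positivity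
  have key : ((3 * x + 5) * (4 * x + 3) * (6 * x + 7)) ^ 3 * (2 * x + 3) =
      ((3 * x + 4) * (4 * x + 7) * (6 * x + 5)) ^ 3 * (2 * x + 1) +
      (728875 + 5143775 * x + 15679125 * x ^ 2 + 26955724 * x ^ 3 + 28587384 * x ^ 4 +
        19154304 * x ^ 5 + 7920720 * x ^ 6 + 1848960 * x ^ 7 + 186624 * x ^ 8) := by
    ring
  nlinarith [key, hQ]

/-- Positivity and the cube bound along the Ikhlef–Ponsaing recursion: if `u 0 = 1` and `u (m+1) · D(m) = u m · N(m)` for all `m`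
(`D(m) = (3m+4)(4m+7)(6m+5)`, `N(m) = (3m+5)(4m+3)(6m+7)`), then `u m > 0` and `(2m+1) · (u m)³ ≥ 1` for all `m`
(`(2m+1)(u m)³` is non-decreasing by `diagArm_step_poly`). -/
theorem one_le_mul_cube_of_recursion (u : ℕ → ℝ) (h0 : u 0 = 1)
    (hrec : ∀ m : ℕ, u (m + 1) * ((3 * (m : ℝ) + 4) * (4 * (m : ℝ) + 7) * (6 * (m : ℝ) + 5)) =
      u m * ((3 * (m : ℝ) + 5) * (4 * (m : ℝ) + 3) * (6 * (m : ℝ) + 7))) :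
    ∀ m : ℕ, 0 < u m ∧ 1 ≤ (2 * (m : ℝ) + 1) * u m ^ 3 := by
  intro m
  induction m with
  | zero => simp [h0]
  | succ m ih =>
    obtain ⟨hpos, hle⟩ := ih
    set D : ℝ := (3 * (m : ℝ) + 4) * (4 * (m : ℝ) + 7) * (6 * (m : ℝ) + 5) with hD
    set N : ℝ := (3 * (m : ℝ) + 5) * (4 * (m : ℝ) + 3) * (6 * (m : ℝ) + 7) with hN
    have hDpos : 0 < D := by rw [hD]; positivity
    have hNpos : 0 < N := by rw [hN]; positivity
    have hu : u (m + 1) = u m * N / D := by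
      rw [eq_div_iff hDpos.ne']
      exact hrec m
    have hpos' : 0 < u (m + 1) := by rw [hu]; positivity
    refine ⟨hpos', ?_⟩
    have hpoly : D ^ 3 * (2 * (m : ℝ) + 1) ≤ N ^ 3 * (2 * (m : ℝ) + 3) :=
      diagArm_step_poly m (Nat.cast_nonneg m)
    -- `(2m+3) u(m+1)^3 = (2m+3) u(m)^3 N^3 / D^3 ≥ (2m+1) u(m)^3 ≥ 1`
    have e : (2 * ((m + 1 : ℕ) : ℝ) + 1) * u (m + 1) ^ 3 = (2 * (m : ℝ) + 3) * N ^ 3 / D ^ 3 * u m ^ 3 := by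
      rw [hu]; push_cast; field_simp; ring
    rw [e]
    have hu3 : 0 ≤ u m ^ 3 := pow_nonneg hpos.le 3
    have hratio : (2 * (m : ℝ) + 1) ≤ (2 * (m : ℝ) + 3) * N ^ 3 / D ^ 3 := by
      rw [le_div_iff₀ (pow_pos hDpos 3)]
      linarith [hpoly]
    calc (1 : ℝ) ≤ (2 * (m : ℝ) + 1) * u m ^ 3 := hle
      _ ≤ (2 * (m : ℝ) + 3) * N ^ 3 / D ^ 3 * u m ^ 3 := mul_le_mul_of_nonneg_right hratio hu3

/-- Cube-root form: under the same recursion, `u m ≥ (2m+1)^{-1/3}`. -/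
theorem rpow_le_of_recursion (u : ℕ → ℝ) (h0 : u 0 = 1)
    (hrec : ∀ m : ℕ, u (m + 1) * ((3 * (m : ℝ) + 4) * (4 * (m : ℝ) + 7) * (6 * (m : ℝ) + 5)) =
      u m * ((3 * (m : ℝ) + 5) * (4 * (m : ℝ) + 3) * (6 * (m : ℝ) + 7))) (m : ℕ) :
    (2 * (m : ℝ) + 1) ^ (-(1:ℝ) / 3) ≤ u m := by
  obtain ⟨hpos, hle⟩ := one_le_mul_cube_of_recursion u h0 hrec m
  have ht : (0 : ℝ) < 2 * (m : ℝ) + 1 := by positivity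
  have hpow : ((2 * (m : ℝ) + 1) ^ (-(1:ℝ) / 3)) ^ 3 = 1 / (2 * (m : ℝ) + 1) := by
    rw [← Real.rpow_natCast ((2 * (m : ℝ) + 1) ^ (-(1:ℝ) / 3)) 3, ← Real.rpow_mul ht.le]
    norm_num [Real.rpow_neg_one, div_eq_mul_inv]
  refine le_of_pow_le_pow_left₀ (by norm_num : (3 : ℕ) ≠ 0) hpos.le ?_
  rw [hpow, div_le_iff₀ ht]
  linarith [hle]

/-- **Registered glue `diagHalfPlaneOneArmLower_of_ikhlefPonsaing` — the diagonal companion of S2, conditional on Ikhlef–Ponsaing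
Prop. 4.7.** Given `IkhlefPonsaingFirstPassage`, for every `n ≥ 1` the diagonal half-plane one-arm probability of bond-`ℤ²` at
`p = 1/2` satisfies `π◇(n) ≥ (2n+1)^{-1/3}`: `P_b(1) = 1`, the recursion (`stub_ipRecursion_of_ikhlefPonsaing`) and
`rpow_le_of_recursion` give `P_b(2n+1) ≥ (2n+1)^{-1/3}`, and `P_b(2n+1) ≤ π◇(n)` is `stub_passageLeArm`. -/
theorem diagHalfPlaneOneArmLower_of_ikhlefPonsaing :
    Literature.Probability.Percolation.IkhlefPonsaingFirstPassage →
    ∀ n : ℕ, 1 ≤ n →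
      (2 * (n : ℝ) + 1) ^ (-(1:ℝ) / 3) ≤
        (bondPercolation (zdGraph 2) half).real
          {ω | ∃ y : Site 2, (y 0 + y 1 = -(n : ℤ) ∨ y 0 - y 1 = (n : ℤ) ∨ y 0 - y 1 = -(n : ℤ)) ∧
            ω ∈ openConnIn {v : Site 2 | v 0 + v 1 ≤ 1 ∧ -(n : ℤ) ≤ v 0 + v 1 ∧
              -(n : ℤ) ≤ v 0 - v 1 ∧ v 0 - v 1 ≤ n} 0 y} := by
  intro hIP n hn
  -- the wall-passage probability `P_b(2m+1)`, inline as in `diagArm_exponent_of_ikhlefPonsaing`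
  let W : ℕ → ℝ := fun m ↦ (bondPercolation (zdGraph 2) half).real
    {ω | ∃ y : Site 2, y 0 + y 1 = 0 ∧
      ω ∈ openConnIn {v : Site 2 | 0 ≤ v 0 + v 1 ∧ v 0 + v 1 ≤ 2 * (m : ℤ) + 1} ![2 * (m : ℤ), 0] y}
  have hrec : ∀ m : ℕ, W (m + 1) * ((3 * (m : ℝ) + 4) * (4 * (m : ℝ) + 7) * (6 * (m : ℝ) + 5)) =
      W m * ((3 * (m : ℝ) + 5) * (4 * (m : ℝ) + 3) * (6 * (m : ℝ) + 7)) :=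
    fun m ↦ stub_ipRecursion_of_ikhlefPonsaing hIP m
  have hW0 : W 0 = 1 := by
    have hmem : (![2 * ((0 : ℕ) : ℤ), 0] : Site 2) ∈
        {v : Site 2 | 0 ≤ v 0 + v 1 ∧ v 0 + v 1 ≤ 2 * ((0 : ℕ) : ℤ) + 1} := by simp
    show (bondPercolation (zdGraph 2) half).real _ = 1
    convert MeasureTheory.probReal_univ (μ := bondPercolation (zdGraph 2) half) using 2
    refine Set.eq_univ_of_forall fun ω => ⟨![2 * ((0 : ℕ) : ℤ), 0], by simp, ?_⟩
    exact ⟨hmem, hmem, SimpleGraph.Reachable.refl _⟩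
  have hlow : (2 * (n : ℝ) + 1) ^ (-(1:ℝ) / 3) ≤ W n := rpow_le_of_recursion W hW0 hrec n
  exact hlow.trans (stub_passageLeArm n hn)

/-- **The diagonal statement in the quantifier shape of S2** (`HalfPlaneOneArmLower` with the diagonal event): given
`IkhlefPonsaingFirstPassage` there is `c > 0` (namely `3^{-1/3}`) with `c n^{-1/3} ≤ π◇(n)` for all large `n`
(`(2n+1)^{-1/3} ≥ (3n)^{-1/3}` for `n ≥ 1`). -/
theorem diagHalfPlaneOneArmLower_eventually_of_ikhlefPonsaing :
    Literature.Probability.Percolation.IkhlefPonsaingFirstPassage →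
    ∃ c : ℝ, 0 < c ∧ ∀ᶠ n : ℕ in atTop,
      c * (n : ℝ) ^ (-((1:ℝ) / 3)) ≤
        (bondPercolation (zdGraph 2) half).real
          {ω | ∃ y : Site 2, (y 0 + y 1 = -(n : ℤ) ∨ y 0 - y 1 = (n : ℤ) ∨ y 0 - y 1 = -(n : ℤ)) ∧
            ω ∈ openConnIn {v : Site 2 | v 0 + v 1 ≤ 1 ∧ -(n : ℤ) ≤ v 0 + v 1 ∧
              -(n : ℤ) ≤ v 0 - v 1 ∧ v 0 - v 1 ≤ n} 0 y} := by
  intro hIP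
  refine ⟨(3 : ℝ) ^ (-((1:ℝ) / 3)), Real.rpow_pos_of_pos (by norm_num) _, ?_⟩
  filter_upwards [eventually_ge_atTop 1] with n hn
  have hn' : (1 : ℝ) ≤ n := by exact_mod_cast hn
  have h := diagHalfPlaneOneArmLower_of_ikhlefPonsaing hIP n hn
  refine le_trans ?_ h
  -- `3^{-1/3} n^{-1/3} = (3n)^{-1/3} ≤ (2n+1)^{-1/3}` since `2n+1 ≤ 3n`
  have hneg : -((1:ℝ) / 3) = -(1:ℝ) / 3 := by ring
  rw [hneg, ← Real.mul_rpow (by norm_num) (by positivity)]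
  exact Real.rpow_le_rpow_of_nonpos (by positivity) (by linarith) (by norm_num)

end Summit.CriticalPhenomena.CardyFormulaZ2.Cruxes.ParafermionToSLESixFamilies.IicTraceFluxPairing

end
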